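import Summits.ResolutionOfSingularities.ResolutionOfSingularities.Theorems.PurelyInseparableDim4ResConeTwoSlotTailSigma
import Summits.ResolutionOfSingularities.ResolutionOfSingularities.Theorems.PurelyInseparableDim4ResConeCInfGameWindowPrime
import HarnessLib
import HarnessLib.Audit.Tags

/-!
# Purely inseparable four-folds — TWO-SLOT POWER-CONE GAME, FINITE-WINDOW σ-ASSEMBLY: a pure-corner two-slot play of straight σ-states in regime
# that starts with the letter change `j, i` lasts fewer than `4(d − 1) + 2` further steps — every prime, every σ = (n, n) + w, `w = 0` allowed
# (cell `res-dim4-pi`, K2(p) lane, B rows, row B-LF (iii-b) «K24a-PRIME-σ», finite-window edition of δ2 for the class-(iii) virtual port; seat res-dim4-p-7 g6)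

[OURS · counted 0 · cell `res-dim4-pi` · K2(p) lane (holder res-dim4-p-12 g5 rulings g5-21: «type the FINITE-WINDOW edition `no_twoSlot_pureCorner_window_sigma
(hT : bound ≤ T)` for res-dim4-typ-1 g5's W5bσ; state the bound you can prove from α»).  COMPOSITION ONLY: the game is res-dim4-p-3 g5's window form
`CInfGame.WindowPrime.no_play_after_change_of_le` (every family constant, bound `4C + 2`, `C = d − 1`) of res-dim4-p-9 g3's C∞ game; the per-step
readings are res-dim4-p-1 g6's step laws (p719168) in res-dim4-p-9 g5's dressing, this seat's β p719195 / p719218 and δ1/δ2 (Tschirnhaus row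
self-supplying, one-step package `inv_step_sigma`).  Shape of the statement = res-dim4-p-3 g5's `no_cInf_corner_window_prime` (light pair) with
(1, 0, d + 1 = p) ↦ (n, w, n + w + d = p): hypotheses only up to the horizon `T + 1`.  Seat res-dim4-p-7 g6.]  Nothing here proves any TAIL(p, d, 3),
K2(7), K2(p), `NoIsolatedTrap p p` or resolution of singularities in dimension ≥ 4 / characteristic `p` — NOT proved; a conditional finite-window
statement about OUR frame (its hypotheses are what typ-1's virtual window delivers, precision budget permitting).  AI kernel work, weaker than
expert review.

* §1 `inv_window_sigma` — δ2's package (σ-boundary, `x^r ∣ F`, `x_f^d`-coefficient, straightness, slot ledger, Tschirnhaus powers of the current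
  letter) at every time `t ≤ T + 1` of a guarded pure play defined up to the horizon.
* §2 **`no_twoSlot_pureCorner_window_sigma (p) [Fact p.Prime] [CharP K p] (hσ : n + w + d = p) (hn : 1 ≤ n) (hd2 : 2 ≤ d) {T} (hT : 4(d−1) + 2 ≤ T)`**:
  guarded pure play for `t ≤ T`, `ord = p + n` / `e_G = 3` / isolated for `t ≤ T + 1`, time-0 package (boundary, `x^r ∣ F`, straight, Tschirnhaus
  coefficient at `x_f^{d−1}x_j²`, slot ledger) and the START `x 0 = true` (`j`), `x 1 = false` (`i`) ⊢ `False`.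
[cite: CossartJannsenSaito2020, Thm. 3.14] [cite: Hauser2010, §§F–G]
bears_on: LADDER-RESOLUTION:D157-DOOR2 (res-dim4-pi · K2(p) · power cones · K24a-PRIME-σ finite-window assembly).  Supports
stmt-ResolutionOfSingularities-16155 (helper).
-/

set_option linter.dupNamespace false -- mandated namespace of this single-conjunct summit

noncomputable section

namespace Summit.ResolutionOfSingularities.ResolutionOfSingularities.Theorems.PIDim4

namespace ResCone

open MvPolynomial Finset
open Literature.AlgebraicGeometry.Resolution
open Literature.AlgebraicGeometry.Resolution.CentreBlowup
open Literature.AlgebraicGeometry.Resolution.Hauser2010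
open Literature.AlgebraicGeometry.Resolution.HauserPerlega2019

variable {K : Type} [Field K] [DecidableEq K]

section Window

variable {j i u f : Fin 4} (hji : j ≠ i) (hju : j ≠ u) (hjf : j ≠ f) (hiu : i ≠ u) (hif : i ≠ f) (huf : u ≠ f)
include hji hju hjf hiu hif huf

/-! ## 1. The package up to the horizon -/

/-- **THE PACKAGE AT EVERY TIME `t ≤ T + 1`** of a guarded pure-corner two-slot play defined up to the horizon `T`, started at a letter change with
the time-0 package (δ2's `inv_play_sigma`, finite-window form). [OURS · composition] -/
theorem inv_window_sigma (p : ℕ) [Fact p.Prime] [CharP K p] {n w d : ℕ} (hσ : n + w + d = p) (hn : 1 ≤ n) (hd2 : 2 ≤ d) {T : ℕ}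
    (s : ℕ → State K) (x : ℕ → Bool)
    (hstep : ∀ t, t ≤ T → (∃ a : K, a ≠ 0 ∧ resForm (s t) = C a * X f ^ d) →
      s (t + 1) = CentreBlowup.step p Finset.univ (if x t then j else i) 0 (s t))
    (hr0 : (s 0).r = Finsupp.single j n + Finsupp.single i n + Finsupp.single u w) (hdiv0 : ∀ e ∈ (s 0).F.support, (s 0).r ≤ e)
    (ho : ∀ t, t ≤ T + 1 → ordZero (s t).F = ((p + n : ℕ) : ℕ∞)) (he3 : ∀ t, t ≤ T + 1 → Module.finrank K (resVertex (s t)) = 3)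
    (ha0 : coeff ((s 0).r + Finsupp.single f d) (s 0).F ≠ 0)
    (hstraight0 : ∀ m : Fin 4 →₀ ℕ, m.degree = d → m ≠ Finsupp.single f d → coeff ((s 0).r + m) (s 0).F = 0)
    (htsch0 : coeff ((s 0).r + (Finsupp.single f (d - 1) + Finsupp.single (if x 0 then j else i) 2)) (s 0).F = 0)
    (hx01 : x 0 ≠ x 1) (hled0 : ∀ e ∈ (s 0).F.support, e f ≤ d - 1 → n + 1 ≤ e j ∧ n + 1 ≤ e i) :
    ∀ t, t ≤ T + 1 →
      (s t).r = Finsupp.single j n + Finsupp.single i n + Finsupp.single u w ∧ (∀ e ∈ (s t).F.support, (s t).r ≤ e) ∧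
      coeff ((s t).r + Finsupp.single f d) (s t).F ≠ 0 ∧
      (∀ m : Fin 4 →₀ ℕ, m.degree = d → m ≠ Finsupp.single f d → coeff ((s t).r + m) (s t).F = 0) ∧
      (∀ e ∈ (s t).F.support, e f ≤ d - 1 → n + 1 ≤ e j ∧ n + 1 ≤ e i) ∧
      (∀ m, 2 ≤ m → (1 ≤ t ∨ m = 2) →
        coeff ((s t).r + (Finsupp.single f (d - 1) + Finsupp.single (if x t then j else i) m)) (s t).F = 0) ∧
      (t ≤ T → s (t + 1) = CentreBlowup.step p Finset.univ (if x t then j else i) 0 (s t)) := by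
  intro t
  induction t with
  | zero =>
    intro _
    have hrdeg : (s 0).r.degree = 2 * n + w := by
      rw [hr0, map_add, map_add, Finsupp.degree_single, Finsupp.degree_single, Finsupp.degree_single]; ring
    refine ⟨hr0, hdiv0, ha0, hstraight0, hled0, fun m hm h01 => ?_, fun hT0 =>
      hstep 0 hT0 ⟨_, ha0, resForm_eq_C_mul_X_pow_of_readings_sigma (ho 0 (by omega)) (by rw [hrdeg]; omega) rfl hstraight0⟩⟩
    rcases h01 with h | rfl
    · omega
    · exact htsch0
  | succ t ih =>
    intro ht1
    obtain ⟨hr, hdiv, ha, hst, hled, hT', hs⟩ := ih (by omega)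
    have hs := hs (by omega)
    have htsch : coeff ((s t).r + (Finsupp.single f (d - 1) + Finsupp.single (if x t then j else i) 2)) (s t).F = 0 :=
      hT' 2 le_rfl (by by_cases h : 1 ≤ t <;> [exact Or.inl h; exact Or.inr rfl])
    have ho' := ho (t + 1) ht1
    have he3' := he3 (t + 1) ht1
    have hguard' : ∀ {S : State K}, S.r = Finsupp.single j n + Finsupp.single i n + Finsupp.single u w →
        ordZero S.F = ((p + n : ℕ) : ℕ∞) → coeff (S.r + Finsupp.single f d) S.F ≠ 0 →
        (∀ m : Fin 4 →₀ ℕ, m.degree = d → m ≠ Finsupp.single f d → coeff (S.r + m) S.F = 0) →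
        ∃ a : K, a ≠ 0 ∧ resForm S = C a * X f ^ d := by
      intro S hrS hoS haS hstS
      have hrdeg : S.r.degree = 2 * n + w := by
        rw [hrS, map_add, map_add, Finsupp.degree_single, Finsupp.degree_single, Finsupp.degree_single]; ring
      exact ⟨_, haS, resForm_eq_C_mul_X_pow_of_readings_sigma hoS (by rw [hrdeg]; omega) rfl hstS⟩
    cases hxt : x t
    · -- step in the slot `i`
      have hs1 : s (t + 1) = CentreBlowup.step p Finset.univ i 0 (s t) := by simpa [hxt] using hs
      rw [hs1] at ho' he3' ⊢
      rw [hxt] at htsch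
      simp only [Bool.false_eq_true, ↓reduceIte] at htsch
      have hr' : (s t).r = Finsupp.single i n + Finsupp.single j n + Finsupp.single u w := by rw [hr, add_comm (Finsupp.single j n)]
      obtain ⟨h1, h2, h3, h4, h5, h6, h7⟩ := inv_step_sigma hji.symm hiu hif hju hjf huf p hσ hn hd2 hr' hdiv (ho t (by omega)) ha hst
        htsch (fun e he hef => (hled e he hef).symm) ho' he3'
      have h1' : (CentreBlowup.step p Finset.univ i 0 (s t)).r = Finsupp.single j n + Finsupp.single i n + Finsupp.single u w := by
        rw [h1, add_comm (Finsupp.single i n)]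
      refine ⟨h1', h2, h3, h4, fun e he hef => (h5 e he hef).symm, fun m hm _ => ?_, fun hT1 => ?_⟩
      · cases hxt1 : x (t + 1)
        · simp only [Bool.false_eq_true, ↓reduceIte]
          rw [h7 m (by omega)]
          have h1t : 1 ≤ t := by
            by_contra h0
            have ht0 : t = 0 := by omega
            subst ht0; exact hx01 (by rw [hxt, hxt1])
          have := hT' (m + 1) (by omega) (Or.inl h1t)
          simpa [hxt] using this
        · simp only [↓reduceIte]
          exact h6 m hm
      · have h := hstep (t + 1) hT1 (by rw [hs1]; exact hguard' h1' ho' h3 h4)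
        rw [hs1] at h
        exact h
    · -- step in the slot `j`
      have hs1 : s (t + 1) = CentreBlowup.step p Finset.univ j 0 (s t) := by simpa [hxt] using hs
      rw [hs1] at ho' he3' ⊢
      rw [hxt] at htsch
      simp only [↓reduceIte] at htsch
      obtain ⟨h1, h2, h3, h4, h5, h6, h7⟩ := inv_step_sigma hji hju hjf hiu hif huf p hσ hn hd2 hr hdiv (ho t (by omega)) ha hst htsch hled
        ho' he3'
      refine ⟨h1, h2, h3, h4, h5, fun m hm _ => ?_, fun hT1 => ?_⟩
      · cases hxt1 : x (t + 1)
        · simp only [Bool.false_eq_true, ↓reduceIte]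
          exact h6 m hm
        · simp only [↓reduceIte]
          rw [h7 m (by omega)]
          have h1t : 1 ≤ t := by
            by_contra h0
            have ht0 : t = 0 := by omega
            subst ht0; exact hx01 (by rw [hxt, hxt1])
          have := hT' (m + 1) (by omega) (Or.inl h1t)
          simpa [hxt] using this
      · have h := hstep (t + 1) hT1 (by rw [hs1]; exact hguard' h1 ho' h3 h4)
        rw [hs1] at h
        exact h

/-! ## 2. The finite window -/

/-- **FINITE-WINDOW σ-ASSEMBLY, every prime, every σ = (n, n) + w (`w = 0` allowed): a pure-corner two-slot play of straight σ-states in regime that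
starts `j, i` cannot be legal and fully flagged up to the horizon `T ≥ 4(d − 1) + 2`.**  Hypotheses only up to the horizon: guarded purity for
`t ≤ T`; `ord₀ = p + n`, `e_G = 3`, isolation for `t ≤ T + 1`; at time 0: σ-boundary, `x^r ∣ F`, straight, the Tschirnhaus coefficient at
`x_f^{d−1}x_j²`, the slot ledger; `x 0 = true` (chart `j`), `x 1 = false` (chart `i`).  Proof: `inv_window_sigma` + the β-readings feed res-dim4-p-3's
`CInfGame.WindowPrime.no_play_after_change_of_le (d − 1) T`. [OURS · composition] [cite: CossartJannsenSaito2020, Thm. 3.14] -/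
theorem no_twoSlot_pureCorner_window_sigma (p : ℕ) [Fact p.Prime] [CharP K p] {n w d : ℕ} (hσ : n + w + d = p) (hn : 1 ≤ n)
    (hd2 : 2 ≤ d) {T : ℕ} (hT : 4 * (d - 1) + 2 ≤ T) (s : ℕ → State K) (x : ℕ → Bool)
    (hstep : ∀ t, t ≤ T → (∃ a : K, a ≠ 0 ∧ resForm (s t) = C a * X f ^ d) →
      s (t + 1) = CentreBlowup.step p Finset.univ (if x t then j else i) 0 (s t))
    (hr0 : (s 0).r = Finsupp.single j n + Finsupp.single i n + Finsupp.single u w) (hdiv0 : ∀ e ∈ (s 0).F.support, (s 0).r ≤ e)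
    (ho : ∀ t, t ≤ T + 1 → ordZero (s t).F = ((p + n : ℕ) : ℕ∞)) (he3 : ∀ t, t ≤ T + 1 → Module.finrank K (resVertex (s t)) = 3)
    (hiso : ∀ t, t ≤ T + 1 → IsIsolated p (s t).F)
    (ha0 : coeff ((s 0).r + Finsupp.single f d) (s 0).F ≠ 0)
    (hstraight0 : ∀ m : Fin 4 →₀ ℕ, m.degree = d → m ≠ Finsupp.single f d → coeff ((s 0).r + m) (s 0).F = 0)
    (htsch0 : coeff ((s 0).r + (Finsupp.single f (d - 1) + Finsupp.single j 2)) (s 0).F = 0)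
    (hled0 : ∀ e ∈ (s 0).F.support, e f ≤ d - 1 → n + 1 ≤ e j ∧ n + 1 ≤ e i)
    (hx0 : x 0 = true) (hx1 : x 1 = false) : False := by
  have hx01 : x 0 ≠ x 1 := by rw [hx0, hx1]; simp
  have htsch0' : coeff ((s 0).r + (Finsupp.single f (d - 1) + Finsupp.single (if x 0 then j else i) 2)) (s 0).F = 0 := by
    rw [hx0]; simpa using htsch0
  have inv := inv_window_sigma hji hju hjf hiu hif huf p hσ hn hd2 s x hstep hr0 hdiv0 ho he3 ha0 hstraight0 htsch0' hx01 hled0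
  -- per-time consequences (up to the horizon)
  have hq : ∀ t, t ≤ T + 1 → ((p : ℕ) : ℕ∞) ≤ ordAlong Finset.univ (s t).F := fun t ht => by
    rw [ordAlong_univ, ho t ht]; exact_mod_cast (by omega : p ≤ p + n)
  have h6 : ∀ t, t ≤ T + 1 → ∀ e ∈ (s t).F.support, p + n ≤ e.degree := fun t ht e he =>
    le_degree_of_mem_support_of_ordZero (ho t ht) he
  have hrdeg : (Finsupp.single j n + Finsupp.single i n + Finsupp.single u w : Fin 4 →₀ ℕ).degree = 2 * n + w := by
    rw [map_add, map_add, Finsupp.degree_single, Finsupp.degree_single, Finsupp.degree_single]; ring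
  have hstr : ∀ t, t ≤ T + 1 → ∀ e ∈ (s t).F.support, e.degree = p + n → e f = d := by
    intro t ht e he hdeg
    obtain ⟨hr, hdiv, -, hst, -, -, -⟩ := inv t ht
    obtain ⟨m, rfl⟩ : ∃ m, e = (s t).r + m := ⟨e - (s t).r, (add_tsub_cancel_of_le (hdiv e he)).symm⟩
    rw [map_add, hr, hrdeg] at hdeg
    have hmd : m.degree = d := by omega
    by_cases hm : m = Finsupp.single f d
    · rw [hm, Finsupp.add_apply, Finsupp.single_eq_same, hr]; simp [hjf.symm, hif.symm, huf.symm]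
    · exact absurd (hst m hmd hm) (MvPolynomial.mem_support_iff.mp he)
  have hrn : ∀ t, t ≤ T + 1 → ∀ e ∈ (s t).F.support, n ≤ e j := fun t ht e he => by
    obtain ⟨hr, hdiv, -⟩ := inv t ht
    have h := hdiv e he j
    rw [hr] at h; simpa [hji, hju] using h
  have hrni : ∀ t, t ≤ T + 1 → ∀ e ∈ (s t).F.support, n ≤ e i := fun t ht e he => by
    obtain ⟨hr, hdiv, -⟩ := inv t ht
    have h := hdiv e he i
    rw [hr] at h; simpa [hji.symm, hiu] using h
  refine CInfGame.WindowPrime.no_play_after_change_of_le (d - 1) T (by omega) hT x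
    (fun t q => q.1 + 1 ≤ d ∧ coeff (Finsupp.single j (q.2.1 + n + 1) + Finsupp.single i (q.2.2.1 + n + 1) +
      Finsupp.single u (q.2.2.2 + w) + Finsupp.single f (d - 1 - q.1)) (s t).F ≠ 0) hx0 hx1
    (fun t c a b e h => by have := h.1; omega) ?_ ?_ ?_ ?_ ?_ ?_ ?_
  · -- hfwdL
    intro t c a b e ht hP hxt hlive
    obtain ⟨-, -, -, -, -, -, hs⟩ := inv t (by omega)
    have hs1 : s (t + 1) = CentreBlowup.step p Finset.univ j 0 (s t) := by simpa [hxt] using hs (by omega)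
    rw [hs1]
    exact game_fwd_slot_j hji hju hjf hiu hif huf p hσ (s t) (hq t (by omega)) (h6 t (by omega)) (hstr t (by omega)) hP hlive
  · -- hfwdM
    intro t c a b e ht hP hxt hlive
    obtain ⟨-, -, -, -, -, -, hs⟩ := inv t (by omega)
    have hs1 : s (t + 1) = CentreBlowup.step p Finset.univ i 0 (s t) := by simpa [hxt] using hs (by omega)
    rw [hs1]
    exact game_fwd_slot_i hji hju hjf hiu hif huf p hσ (s t) (hq t (by omega)) (h6 t (by omega)) (hstr t (by omega)) hP hlive
  · -- hlegL
    intro t c a b e ht hP hxt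
    obtain ⟨hr, hdiv, ha, hst, hled, hT', hs⟩ := inv t (by omega)
    have htsch := hT' 2 le_rfl (by by_cases h : 1 ≤ t <;> [exact Or.inl h; exact Or.inr rfl])
    have ho' := ho (t + 1) (by omega)
    have he3' := he3 (t + 1) (by omega)
    have hs1 : s (t + 1) = CentreBlowup.step p Finset.univ j 0 (s t) := by simpa [hxt] using hs ht
    rw [hs1] at ho' he3'
    rw [hxt] at htsch
    simp only [↓reduceIte] at htsch
    exact twoSlot_legal_gameExp_sigma hji hju hjf hiu hif huf p hσ hn hd2 hr hdiv (ho t (by omega)) ha hst htsch ho' he3' hP.1 hP.2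
  · -- hlegM
    intro t c a b e ht hP hxt
    obtain ⟨hr, hdiv, ha, hst, hled, hT', hs⟩ := inv t (by omega)
    have htsch := hT' 2 le_rfl (by by_cases h : 1 ≤ t <;> [exact Or.inl h; exact Or.inr rfl])
    have ho' := ho (t + 1) (by omega)
    have he3' := he3 (t + 1) (by omega)
    have hs1 : s (t + 1) = CentreBlowup.step p Finset.univ i 0 (s t) := by simpa [hxt] using hs ht
    rw [hs1] at ho' he3'
    rw [hxt] at htsch
    simp only [Bool.false_eq_true, ↓reduceIte] at htsch
    exact twoSlot_legalM_gameExp_sigma hji hju hjf hiu hif huf p hσ hn hd2 hr hdiv (ho t (by omega)) ha hst htsch ho' he3' hP.1 hP.2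
  · -- hevol
    intro t c a b e ht hP
    obtain ⟨hr, hdiv, ha, hst, hled, -, hs⟩ := inv t (by omega)
    have hs := hs (by omega)
    cases hxt : x t
    · have hs1 : s (t + 1) = CentreBlowup.step p Finset.univ i 0 (s t) := by simpa [hxt] using hs
      rw [hs1] at hP
      rcases game_evol_slot_i hji hju hjf hiu hif huf p hσ (s t) (hrni t (by omega)) (fun e he hef => (hled e he hef).2) hP with
        hdead | ⟨a₀, b₀, hP₀, ha', hb'⟩
      · exact Or.inl hdead
      · exact Or.inr ⟨a₀, b₀, hP₀, Or.inr ⟨rfl, ha', hb'⟩⟩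
    · have hs1 : s (t + 1) = CentreBlowup.step p Finset.univ j 0 (s t) := by simpa [hxt] using hs
      rw [hs1] at hP
      rcases game_evol_slot_j hji hju hjf hiu hif huf p hσ (s t) (hrn t (by omega)) (fun e he hef => (hled e he hef).1) hP with
        hdead | ⟨a₀, b₀, hP₀, ha', hb'⟩
      · exact Or.inl hdead
      · exact Or.inr ⟨a₀, b₀, hP₀, Or.inl ⟨rfl, ha', hb'⟩⟩
  · -- hflagL
    intro t _ ht
    obtain ⟨hr, hdiv, -, -, hled, -, -⟩ := inv t (by omega)
    obtain ⟨c, a, b, e, hc, h, hf⟩ := twoSlot_flagL_gameExp_sigma hji hju hjf hiu hif huf p hσ hr (hiso t (by omega)) hdiv hled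
    exact ⟨c, a, b, e, ⟨hc, h⟩, hf⟩
  · -- hflagM
    intro t _ ht
    obtain ⟨hr, hdiv, -, -, hled, -, -⟩ := inv t (by omega)
    obtain ⟨c, a, b, e, hc, h, hf⟩ := twoSlot_flagM_gameExp_sigma hji hju hjf hiu hif huf p hσ hr (hiso t (by omega)) hdiv hled
    exact ⟨c, a, b, e, ⟨hc, h⟩, hf⟩

end Window

end ResCone

end Summit.ResolutionOfSingularities.ResolutionOfSingularities.Theorems.PIDim4

end
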